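import Mathlib

/-!
# T5IsotypicRestrict — isotypic components under restriction to a subgroup: (A2)(iv)

Cell pub-hodge-repro2, seat p5, Tier 5 (route/T5-N4-p5.md, N4.3 v13 (A2)(iv), l. 145: «For an
irreducible τ of K_∞ = Z_∞·K^{ss}, Z_∞ acts on τ by scalars (Schur for the finite-dimensional τ), so
τ|_{K^{ss}} is irreducible and V_τ ⊆ V_{τ|_{K^{ss}}}; hence dim V_τ < ∞» — admissibility passes from
the semisimple part `K^{ss}` (where [KV] Thm 0.3 applies) to `K_∞`).  In module language, for a
homomorphism `j : K' →* K` («K^{ss} ⊂ K_∞»), a representation `ρ` of `K` on `V` («π_∞») and a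
representation `τ` of `K` («the K_∞-type»):

* `compRep`, `ofComp` / `toComp`: the restricted representation `ρ ∘ j` and the identity maps between
  the two module structures on `V`; `asAlgebraHom_comp`, `ofComp_smul`: the group algebra of `K'` acts
  on `(compRep j ρ).asModule` through `MonoidAlgebra.mapDomainRingHom k j`;
* `restrictSubmodule`, `restrictEquiv`: a `k[K]`-submodule of `ρ.asModule` is a `k[K']`-submodule of
  `(compRep j ρ).asModule`, and a `k[K]`-linear equivalence with `τ.asModule` restricts to a
  `k[K']`-linear equivalence with `(compRep j τ).asModule`;
* **`mem_isotypicComponent_comp_of_mem`**: «V_τ ⊆ V_{τ|_{K'}}» — the `τ`-isotypic component of `ρ`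
  is contained in the `τ|_{K'}`-isotypic component of `ρ|_{K'}` (both simple);
* `isotypicComponentRestrict`, **`finite_isotypicComponent_of_comp`**,
  **`finrank_isotypicComponent_le_comp`**: hence `dim_k V_τ ≤ dim_k V_{τ|_{K'}} < ∞`;
* `extendSubmodule`, **`isSimpleModule_comp_of_central`**: «τ|_{K^{ss}} is irreducible» — if every
  `g ∈ K` is `z * j g'` with `τ z` a scalar, a simple `τ` restricts to a simple `compRep j τ`.

Mathlib only.  Axioms: propext, Classical.choice, Quot.sound.
README §8(d): uses an L-value-free non-vanishing device: NO.
-/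

namespace Summit.Ventures.HodgeRepro2.T5IsotypicRestrict

open MonoidAlgebra

section Restrict

variable {k : Type*} [CommSemiring k] {K K' : Type*} [Monoid K] [Monoid K'] (j : K' →* K)
variable {V : Type*} [AddCommMonoid V] [Module k V] (ρ : Representation k K V)

/-- The restriction `ρ ∘ j` of a representation of `K` along `j : K' →* K`, as a
`Representation k K' V`. -/
abbrev compRep : Representation k K' V := ρ.comp j

/-- `compRep j ρ g' = ρ (j g')`. -/
@[simp] theorem compRep_apply (g' : K') : compRep j ρ g' = ρ (j g') := rfl

/-- The identity map from the `k[K']`-module `(compRep j ρ).asModule` to the `k[K]`-module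
`ρ.asModule` (both are `V`). -/
def ofComp (x : (compRep j ρ).asModule) : ρ.asModule := x

/-- The identity map from `ρ.asModule` to `(compRep j ρ).asModule`. -/
def toComp (x : ρ.asModule) : (compRep j ρ).asModule := x

/-- `ofComp ∘ toComp = id`. -/
@[simp] theorem ofComp_toComp (x : ρ.asModule) : ofComp j ρ (toComp j ρ x) = x := rfl
/-- `toComp ∘ ofComp = id`. -/
@[simp] theorem toComp_ofComp (x : (compRep j ρ).asModule) : toComp j ρ (ofComp j ρ x) = x := rfl
/-- `ofComp` is additive. -/
@[simp] theorem ofComp_add (x y : (compRep j ρ).asModule) :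
    ofComp j ρ (x + y) = ofComp j ρ x + ofComp j ρ y := rfl
/-- `ofComp 0 = 0`. -/
@[simp] theorem ofComp_zero : ofComp j ρ 0 = 0 := rfl
/-- `toComp` is additive. -/
@[simp] theorem toComp_add (x y : ρ.asModule) : toComp j ρ (x + y) = toComp j ρ x + toComp j ρ y :=
  rfl
/-- `toComp 0 = 0`. -/
@[simp] theorem toComp_zero : toComp j ρ 0 = 0 := rfl
/-- `ofComp` is injective (it is the identity). -/
theorem ofComp_injective : Function.Injective (ofComp j ρ) := fun _ _ h => h
/-- `toComp` is injective (it is the identity). -/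
theorem toComp_injective : Function.Injective (toComp j ρ) := fun _ _ h => h

/-- The group algebra of `K'` acts on `(compRep j ρ).asModule` through `mapDomainRingHom k j`. -/
theorem asAlgebraHom_comp (a : MonoidAlgebra k K') :
    (compRep j ρ).asAlgebraHom a = ρ.asAlgebraHom (MonoidAlgebra.mapDomainRingHom k j a) := by
  induction a using MonoidAlgebra.induction_linear with
  | zero => simp
  | add a b ha hb => rw [map_add, map_add, map_add, ha, hb]
  | single g c =>
    rw [Representation.asAlgebraHom_single, MonoidAlgebra.mapDomainRingHom_apply,
      MonoidAlgebra.mapDomain_single, Representation.asAlgebraHom_single, compRep_apply]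

/-- **`a • x` in `(compRep j ρ).asModule` is `mapDomainRingHom k j a • x` in `ρ.asModule`.** -/
theorem ofComp_smul (a : MonoidAlgebra k K') (x : (compRep j ρ).asModule) :
    ofComp j ρ (a • x) = (MonoidAlgebra.mapDomainRingHom k j a) • ofComp j ρ x := by
  change (compRep j ρ).asAlgebraHom a x = ρ.asAlgebraHom (MonoidAlgebra.mapDomainRingHom k j a) x
  rw [asAlgebraHom_comp]

/-- `k`-scalars commute with `ofComp`. -/
@[simp] theorem ofComp_smul_k (c : k) (x : (compRep j ρ).asModule) :
    ofComp j ρ (c • x) = c • ofComp j ρ x := rfl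

/-- A `k[K]`-submodule of `ρ.asModule`, read as a `k[K']`-submodule of `(compRep j ρ).asModule`
(same carrier). -/
def restrictSubmodule (m : Submodule (MonoidAlgebra k K) ρ.asModule) :
    Submodule (MonoidAlgebra k K') (compRep j ρ).asModule where
  carrier := {x | ofComp j ρ x ∈ m}
  add_mem' {x y} hx hy := by
    simp only [Set.mem_setOf_eq, ofComp_add] at hx hy ⊢
    exact m.add_mem hx hy
  zero_mem' := by simp
  smul_mem' a x hx := by
    simp only [Set.mem_setOf_eq, ofComp_smul] at hx ⊢
    exact m.smul_mem _ hx

/-- Membership in `restrictSubmodule`. -/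
theorem mem_restrictSubmodule (m : Submodule (MonoidAlgebra k K) ρ.asModule)
    (x : (compRep j ρ).asModule) : x ∈ restrictSubmodule j ρ m ↔ ofComp j ρ x ∈ m :=
  Iff.rfl

variable {T : Type*} [AddCommMonoid T] [Module k T] (τ : Representation k K T)

/-- A `k[K]`-linear equivalence `m ≃ τ.asModule` restricts to a `k[K']`-linear equivalence
`restrictSubmodule m ≃ (compRep j τ).asModule`. -/
noncomputable def restrictEquiv (m : Submodule (MonoidAlgebra k K) ρ.asModule)
    (e : m ≃ₗ[MonoidAlgebra k K] τ.asModule) :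
    restrictSubmodule j ρ m ≃ₗ[MonoidAlgebra k K'] (compRep j τ).asModule where
  toFun x := toComp j τ (e ⟨ofComp j ρ x, x.2⟩)
  invFun y := ⟨toComp j ρ (e.symm (ofComp j τ y)), by
    rw [mem_restrictSubmodule, ofComp_toComp]
    exact (e.symm _).2⟩
  left_inv x := by
    apply Subtype.ext
    change toComp j ρ (e.symm (ofComp j τ (toComp j τ (e ⟨ofComp j ρ x, x.2⟩)))) = x
    rw [ofComp_toComp, LinearEquiv.symm_apply_apply]
    rfl
  right_inv y := by
    change toComp j τ (e ⟨ofComp j ρ (toComp j ρ (e.symm (ofComp j τ y))), _⟩) = y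
    have : (⟨ofComp j ρ (toComp j ρ (e.symm (ofComp j τ y))), by
        rw [ofComp_toComp]; exact (e.symm _).2⟩ : m) = e.symm (ofComp j τ y) := by
      apply Subtype.ext
      rfl
    rw [this, LinearEquiv.apply_symm_apply]
    rfl
  map_add' x y := by
    change toComp j τ (e ⟨ofComp j ρ (x + y), _⟩) = toComp j τ (e ⟨ofComp j ρ x, x.2⟩) +
      toComp j τ (e ⟨ofComp j ρ y, y.2⟩)
    have : (⟨ofComp j ρ (x + y), (x + y).2⟩ : m) = ⟨ofComp j ρ x, x.2⟩ + ⟨ofComp j ρ y, y.2⟩ := by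
      apply Subtype.ext
      rfl
    rw [this, map_add]
    rfl
  map_smul' a x := by
    simp only [RingHom.id_apply]
    change toComp j τ (e ⟨ofComp j ρ (a • x), _⟩) = a • toComp j τ (e ⟨ofComp j ρ x, x.2⟩)
    have : (⟨ofComp j ρ (a • x), (a • x).2⟩ : m) =
        (MonoidAlgebra.mapDomainRingHom k j a) • ⟨ofComp j ρ x, x.2⟩ := by
      apply Subtype.ext
      change ofComp j ρ ((a • x : restrictSubmodule j ρ m) : (compRep j ρ).asModule) = _
      rw [Submodule.coe_smul, ofComp_smul]
      rfl
    rw [this, map_smul]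
    apply ofComp_injective j τ
    rw [ofComp_toComp, ofComp_smul, ofComp_toComp]

end Restrict

section Isotypic

variable {k : Type*} [Field k] {K K' : Type*} [Monoid K] [Monoid K'] (j : K' →* K)
variable {V : Type*} [AddCommGroup V] [Module k V] (ρ : Representation k K V)
variable {T : Type*} [AddCommGroup T] [Module k T] (τ : Representation k K T)

/-- **«V_τ ⊆ V_{τ|_{K'}}»**: the `τ`-isotypic component of `ρ` is contained in the `τ|_{K'}`-isotypic
component of `ρ|_{K'}` (both `τ.asModule` and `(compRep j τ).asModule` simple). -/
theorem mem_isotypicComponent_comp_of_mem [IsSimpleModule (MonoidAlgebra k K) τ.asModule]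
    [IsSimpleModule (MonoidAlgebra k K') (compRep j τ).asModule] (x : ρ.asModule)
    (hx : x ∈ isotypicComponent (MonoidAlgebra k K) ρ.asModule τ.asModule) :
    toComp j ρ x ∈
      isotypicComponent (MonoidAlgebra k K') (compRep j ρ).asModule (compRep j τ).asModule := by
  rw [isotypicComponent, sSup_eq_iSup'] at hx
  refine Submodule.iSup_induction (fun m : {m : Submodule (MonoidAlgebra k K) ρ.asModule |
      Nonempty (m ≃ₗ[MonoidAlgebra k K] τ.asModule)} => (m : Submodule (MonoidAlgebra k K) ρ.asModule))
    (motive := fun y => toComp j ρ y ∈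
      isotypicComponent (MonoidAlgebra k K') (compRep j ρ).asModule (compRep j τ).asModule)
    hx ?_ ?_ ?_
  · rintro ⟨m, ⟨e⟩⟩ y hy
    have hle : restrictSubmodule j ρ m ≤
        isotypicComponent (MonoidAlgebra k K') (compRep j ρ).asModule (compRep j τ).asModule :=
      le_sSup ⟨restrictEquiv j ρ τ m e⟩
    apply hle
    rw [mem_restrictSubmodule, ofComp_toComp]
    exact hy
  · rw [toComp_zero]
    exact Submodule.zero_mem _
  · intro y z hy hz
    rw [toComp_add]
    exact Submodule.add_mem _ hy hz

/-- The `k`-linear inclusion of `V_τ` into `V_{τ|_{K'}}`. -/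
def isotypicComponentRestrict [IsSimpleModule (MonoidAlgebra k K) τ.asModule]
    [IsSimpleModule (MonoidAlgebra k K') (compRep j τ).asModule] :
    isotypicComponent (MonoidAlgebra k K) ρ.asModule τ.asModule →ₗ[k]
      isotypicComponent (MonoidAlgebra k K') (compRep j ρ).asModule (compRep j τ).asModule where
  toFun x := ⟨toComp j ρ x, mem_isotypicComponent_comp_of_mem j ρ τ x x.2⟩
  map_add' x y := by
    apply Subtype.ext
    rfl
  map_smul' c x := by
    apply Subtype.ext
    rfl

/-- The inclusion `V_τ → V_{τ|_{K'}}` is injective. -/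
theorem isotypicComponentRestrict_injective [IsSimpleModule (MonoidAlgebra k K) τ.asModule]
    [IsSimpleModule (MonoidAlgebra k K') (compRep j τ).asModule] :
    Function.Injective (isotypicComponentRestrict j ρ τ) := by
  intro x y hxy
  apply Subtype.ext
  have h := congrArg (fun z : isotypicComponent (MonoidAlgebra k K') (compRep j ρ).asModule
    (compRep j τ).asModule => ofComp j ρ (z : (compRep j ρ).asModule)) hxy
  simpa only [isotypicComponentRestrict, LinearMap.coe_mk, AddHom.coe_mk, ofComp_toComp] using h

/-- **«hence dim V_τ < ∞»**: `V_τ` is finite-dimensional whenever `V_{τ|_{K'}}` is (admissibility for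
`K^{ss}` gives admissibility for `K_∞ = Z_∞·K^{ss}`). -/
theorem finite_isotypicComponent_of_comp [IsSimpleModule (MonoidAlgebra k K) τ.asModule]
    [IsSimpleModule (MonoidAlgebra k K') (compRep j τ).asModule]
    [Module.Finite k
      (isotypicComponent (MonoidAlgebra k K') (compRep j ρ).asModule (compRep j τ).asModule)] :
    Module.Finite k (isotypicComponent (MonoidAlgebra k K) ρ.asModule τ.asModule) :=
  Module.Finite.of_injective (isotypicComponentRestrict j ρ τ)
    (isotypicComponentRestrict_injective j ρ τ)

/-- `dim_k V_τ ≤ dim_k V_{τ|_{K'}}`. -/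
theorem finrank_isotypicComponent_le_comp [IsSimpleModule (MonoidAlgebra k K) τ.asModule]
    [IsSimpleModule (MonoidAlgebra k K') (compRep j τ).asModule]
    [Module.Finite k
      (isotypicComponent (MonoidAlgebra k K') (compRep j ρ).asModule (compRep j τ).asModule)] :
    Module.finrank k (isotypicComponent (MonoidAlgebra k K) ρ.asModule τ.asModule) ≤
      Module.finrank k
        (isotypicComponent (MonoidAlgebra k K') (compRep j ρ).asModule (compRep j τ).asModule) :=
  LinearMap.finrank_le_finrank_of_injective (isotypicComponentRestrict_injective j ρ τ)

end Isotypic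

section Central

variable {k : Type*} [CommRing k] {K K' : Type*} [Monoid K] [Monoid K'] (j : K' →* K)
variable {T : Type*} [AddCommGroup T] [Module k T] (τ : Representation k K T)

/-- `single g c • x` on `τ.asModule` when `g = z * j g'` with `τ z = c' • id`: it is
`single g' (c * c') • x` on `(compRep j τ).asModule`. -/
theorem toComp_single_smul {z : K} {g' : K'} {c' : k} (hz : τ z = c' • LinearMap.id) (c : k)
    (x : τ.asModule) :
    toComp j τ (MonoidAlgebra.single (z * j g') c • x) =
      MonoidAlgebra.single g' (c * c') • toComp j τ x := by
  apply ofComp_injective j τ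
  rw [ofComp_smul, ofComp_toComp, ofComp_toComp, MonoidAlgebra.mapDomainRingHom_apply,
    MonoidAlgebra.mapDomain_single, Representation.single_smul, Representation.single_smul,
    map_mul, Module.End.mul_apply, hz, LinearMap.smul_apply, LinearMap.id_apply, smul_smul]

/-- A `k[K']`-submodule of `(compRep j τ).asModule` is a `k[K]`-submodule of `τ.asModule` when every
`g ∈ K` factors as `z * j g'` with `τ z` a scalar («Z acts on τ by scalars»). -/
def extendSubmodule
    (hgen : ∀ g : K, ∃ (z : K) (g' : K'), g = z * j g' ∧ ∃ c : k, τ z = c • LinearMap.id)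
    (N : Submodule (MonoidAlgebra k K') (compRep j τ).asModule) :
    Submodule (MonoidAlgebra k K) τ.asModule where
  carrier := {x | toComp j τ x ∈ N}
  add_mem' {x y} hx hy := by
    simp only [Set.mem_setOf_eq, toComp_add] at hx hy ⊢
    exact N.add_mem hx hy
  zero_mem' := by simp
  smul_mem' a x hx := by
    simp only [Set.mem_setOf_eq] at hx ⊢
    induction a using MonoidAlgebra.induction_linear with
    | zero => simp
    | add a b ha hb =>
      rw [add_smul, toComp_add]
      exact N.add_mem ha hb
    | single g c =>
      obtain ⟨z, g', rfl, c', hc'⟩ := hgen g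
      rw [toComp_single_smul j τ hc']
      exact N.smul_mem _ hx

/-- Membership in `extendSubmodule`. -/
theorem mem_extendSubmodule (hgen) (N : Submodule (MonoidAlgebra k K') (compRep j τ).asModule)
    (x : τ.asModule) : x ∈ extendSubmodule j τ hgen N ↔ toComp j τ x ∈ N :=
  Iff.rfl

/-- **«τ|_{K^{ss}} is irreducible»**: if every `g ∈ K` factors as `z * j g'` with `τ z` a scalar and
`τ` is simple, then `compRep j τ` is simple. -/
theorem isSimpleModule_comp_of_central
    (hgen : ∀ g : K, ∃ (z : K) (g' : K'), g = z * j g' ∧ ∃ c : k, τ z = c • LinearMap.id)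
    [hτ : IsSimpleModule (MonoidAlgebra k K) τ.asModule] :
    IsSimpleModule (MonoidAlgebra k K') (compRep j τ).asModule := by
  haveI : Nontrivial (compRep j τ).asModule := by
    haveI := IsSimpleModule.nontrivial (MonoidAlgebra k K) τ.asModule
    exact (Equiv.ofBijective (ofComp j τ) ⟨ofComp_injective j τ, fun y => ⟨toComp j τ y, rfl⟩⟩).nontrivial
  refine { eq_bot_or_eq_top := fun N => ?_ }
  rcases hτ.eq_bot_or_eq_top (extendSubmodule j τ hgen N) with h | h
  · left
    rw [Submodule.eq_bot_iff] at h ⊢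
    intro y hy
    have hmem : ofComp j τ y ∈ extendSubmodule j τ hgen N := by
      rw [mem_extendSubmodule, toComp_ofComp]
      exact hy
    have := h _ hmem
    exact ofComp_injective j τ this
  · right
    rw [Submodule.eq_top_iff'] at h ⊢
    intro y
    have := h (ofComp j τ y)
    rw [mem_extendSubmodule, toComp_ofComp] at this
    exact this

end Central

end Summit.Ventures.HodgeRepro2.T5IsotypicRestrict
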